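import Summits.QuantumFields.BalabanUV.Beta.GAN24.SourcePairingLevelOneClosed
import Summits.QuantumFields.BalabanUV.Beta.GAN24.ExplicitSourceFormPeriodic
import Summits.QuantumFields.BalabanUV.Beta.GAN24.MultiplierColumnCoarseGauge

/-!
# `BalabanUV.Beta.GAN24.SourcePairingLevelOneExplicit` — binder row G-an2-4 ∕ (CONV-C), the (S) row ∕ (W-γ) one level up, the (η) step at the base, PART 3:
# **ROAD-P2's `hX` AT `j = 0` — the column pairing of `ExplicitSourceFormLambdaShare.moments_sigmaPair_exit_succ_of_columnPairing` at the base level, at Bałaban's pins,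
# for the explicit source form `n⋆`** (`Lc` odd, centred root, `cE = Lc^{d+1}`, `cVH = −Lc^{d+1}·½·Lc^{d+1}`, every `cΛ`, `α ≠ β`)
# (G-an2-4 CRUX TEAM (2), seat `b2b-balaban-gan24-formalise-leaf-06` = the (γ) hand, gen 50, INTENT 4)

NOT IN PRINT; OUR BOOKKEEPING ([folklore] BY NAME over TODAY's PART 2 `SourcePairingLevelOneClosed.sourcePairing_levelOne_closed` (the level-one closed form for periodic data),
road-P2's `ExplicitSourceFormPeriodic` (`n⋆` is bounded and `Lc`-periodic) and (ΛS) `ExplicitSourceFormLambdaShare.contourSum_bondSum_blockInd_explicitSourceForm_eq_zero`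
(`𝒬(σ_{1_{B(y)}}⊙n⋆) = 0`), leaf-06 g49's (T1) `DataColumnCombRows.E2row_colH_eq_contourSumAdj_colM_succ` ((E3): the multiplier response of a two-level datum is a coarse gradient)
and (T1b) `MultiplierColumnCoarseGauge.tsum_wΦ_mul_grad_eq_zero_bdd` (bounded coarse Ward), leaf-14's `MultiplierZeroMass.tsum_wΦ_sub_left` (zero mass), leaf-06 g46's adjointness
`RelInvWardPairing.tsum_mul_contourSumAdj_bdd`; 0 `def`, 0 cited fact, 0 `def … : Prop`, 0 sorry).
HONEST FRAMING (cell contract, verbatim): «discharging `BetaPertH` makes Bałaban's UV stability UNCONDITIONAL — a real constructive-QFT result; it is NOT the continuum limit and NOT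
the Clay problem.»  HONEST DEPENDENCY (verbatim): «continuum YM on T⁴ ⇐ BetaPertH ∧ nine spine estimates (0/9 proved); BetaPertH ⇐ (D1) ∧ (D4) ∧ CAP+tail; G-an2-4 gates asym,
D1 and NE2/3/4.»

WHY.  PART 2 gives `X_1(h; n, 1_{B(y)}) = −½·Σ h·(1⁺_{B(y)}·C_0 n) + ¼·Σ (C_0 h)·(σ_{1_{B(y)}}⊙n)` for every bounded `Lc`-periodic `n` and `h = colH G_1(ν,y′)`.  At road-P2's datum
`n := n⋆_c = Π^ρ(c·Π^ρ m̃) − Lc^{−(d+1)}·𝒬(c·Π^ρ m̃)(·,0)·𝟙[exit]`: (i) the `σ`-term VANISHES — `C_0 h = (stepScale_1∕wVH_1)·𝒬ᵀ(colM G_1(ν,y′))` ((E3)), adjointness, and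
`𝒬(σ_{1_{B(y)}}⊙n⋆) = 0` ((ΛS)); (ii) `C_0 n⋆ = C_0(c·Π^ρ m̃)` — `Π^ρ` is the identity on `c·Π^ρ m̃`, and the exit-indicator correction has ZERO multiplier response (§1: the exit
indicator of one coordinate is `1∕Lc` plus the coarse gradient of the bounded potential `−(u_κ mod Lc)∕Lc`, so zero mass + the bounded coarse Ward kill it); (iii) the weights:
`cE·wE_1 = stepScale_1·Lc^{d+1}·wVH_1` (`= Lc^{4d+7}`).  Under `hX`'s displayed hypothesis `C^{ee}(S_1)(κ,u) = wVH_1·Σ'_v Σ_l wΦ_{Lc} κ l (u − v)·(c·Π^ρ m̃)(l,v)` the two sides agree.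
* §1 `emod_add_one_eq`, `tsum_exitInd_mul_wΦ_eq_zero` (the exit indicator of one coordinate reads nothing on the multiplier-response kernel: `Σ'_u 𝟙[u_κ ≡ −1 (Lc)]·wΦ_N l κ (t − u) = 0`).
* §2 **`multResponse_explicitSourceForm_eq`** (`(C_0 n⋆)(l,t) = Σ'_v Σ_l′ wΦ_{Lc} l l′ (t − v)·(c·Π^ρ m̃)(l′,v)`).
* §3 **`sigmaWeight_multResponse_explicitSourceForm_eq_zero`** (the `σ`-term of PART 2 vanishes at `n⋆`).
* §4 **`columnPairing_levelOne_explicitSourceForm`** — `hX` at `j = 0`, in road-P2's letters (`SrecAt … 0`, `KInvStep Lc (0+1)`, `wE ∕ wVH ∕ stepScale (0+1)`, `u + Pi.single κ 1`).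
Asserts NO value of any resolvent column beyond the inputs named; this is ONE LEVEL (`j = 0`) of road-P2's `hX` at the PINNED weights, NOT `hX` at levels ≥ 1 (the cubic sector
recurses — `CubicSectorLevelDown` — and the lower defects need the β-chain); NOTHING of (W-γ) at levels ≥ 2 ∕ (INV) ∕ (Π) ∕ (S) beyond level 1 discharged; NEVER «G-an2-4 closed» as
(CONV-C); NOT D1, NOT `BetaPertH`, NOT continuum, NOT Clay.  2026-08-23; no existing file touched.
-/

noncomputable section

open Finset
open scoped BigOperators
open Literature.MathematicalPhysics.QuantumFieldTheory
open Literature.MathematicalPhysics.QuantumFieldTheory.Balaban1983to89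
open Literature.MathematicalPhysics.QuantumFieldTheory.Balaban1983to89.Beta
open B12Sec2to5 (l1 l1_nonneg)
open ExpKernelCalculus (Site MKer Decays Zl summable_exp_shift')
open OneStepResolventKernel (Fib)
open LatticeForm (quo)
open AffineAveraging (Form1 box toSite unitVec unitVec_apply dz contourSum)
open AffineReproduction (contourSumAdj)
open AveragingContours (blk)
open AveragingContoursRooted (ctrOff ctrOff_mem_box)
open RootedComb (axProjAt)
open KernelSpecInstance (wΦ)
open OneStepKernelFamily (KInvStep colH)
open SecondOrderResponse (colM)
open BalabanStepJetsSucc (wE wVH)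
open Summit.QuantumFields.BalabanUV.Beta.AxialDressingRooted (coDressKBmAt decays_coDressKBmAt_KInvStep spr_coDressKBmAt one_le_of_neZero)
open Summit.QuantumFields.BalabanUV.Beta.BorderedHessian (stepScale spr_KInvStep)
open Summit.QuantumFields.BalabanUV.Beta.SpineRooted (S0NAt e3OfK SpureRecAt)
open Summit.QuantumFields.BalabanUV.Beta.WardLocusRecursive (SrecAt SrecAt_zero)
open Summit.QuantumFields.BalabanUV.Beta.KernelWardMColumn (colM_coDressKBmAt)
open Summit.QuantumFields.BalabanUV.Beta.GAN24.MultiplierZeroMass (colM_KInvStep summable_wΦ tsum_wΦ_sub_left)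
open Summit.QuantumFields.BalabanUV.Beta.GAN24.MultiplierVertexBondSum (abs_colM_le_fine)
open Summit.QuantumFields.BalabanUV.Beta.GAN24.MultiplierColumnCoarseGauge (tsum_wΦ_mul_grad_eq_zero_bdd)
open Summit.QuantumFields.BalabanUV.Beta.GAN24.CoarseGaugeSourceResponse (summable_bdd_mul)
open Summit.QuantumFields.BalabanUV.Beta.GAN24.RelInvWardPairing (tsum_mul_contourSumAdj_bdd summable_abs_comp_quo)
open Summit.QuantumFields.BalabanUV.Beta.GAN24.ChargeTowerClimb (summable_colH)
open Summit.QuantumFields.BalabanUV.Beta.GAN24.DataColumnCombRows (E2row_colH_eq_contourSumAdj_colM_succ)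
open Summit.QuantumFields.BalabanUV.Beta.GAN24.ExplicitSourceFormLambdaShare (axProjAt_explicitPotential_eq_self contourSum_bondSum_blockInd_explicitSourceForm_eq_zero)
open Summit.QuantumFields.BalabanUV.Beta.GAN24.ExplicitSourceFormPeriodic (exists_abs_le_of_blockPeriodic explicitPotential_blockPeriodic explicitSourceForm_blockPeriodic
  exists_abs_explicitSourceForm_le)
open Summit.QuantumFields.BalabanUV.Beta.GAN24.SourcePairingLevelOneClosed (abs_multResponse_le slotSum_mul_colM_eq sourcePairing_levelOne_closed)

namespace Summit.QuantumFields.BalabanUV.Beta.GAN24.SourcePairingLevelOneExplicit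

variable {d : ℕ} {Lc : ℕ} [NeZero Lc]
/-! ## §1 The exit indicator of one coordinate reads nothing on the multiplier-response kernel -/

omit [NeZero Lc] in
/-- [folklore] `(a + 1) mod P` from `a mod P` (`0 < P`): it wraps to `0` exactly at the last residue. -/
theorem emod_add_one_eq {P : ℤ} (hP : 0 < P) (a : ℤ) : (a + 1) % P = if a % P = P - 1 then 0 else a % P + 1 := by
  have h0 : 0 ≤ a % P := Int.emod_nonneg _ hP.ne'
  have h1 : a % P < P := Int.emod_lt_of_pos _ hP
  rw [← Int.emod_add_emod a P 1]
  by_cases h : a % P = P - 1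
  · rw [if_pos h, h, sub_add_cancel, Int.emod_self]
  · rw [if_neg h]
    exact Int.emod_eq_of_lt (by omega) (by omega)

/-- NOT IN PRINT; OUR BOOKKEEPING.  **THE EXIT INDICATOR OF ONE COORDINATE READS NOTHING ON THE MULTIPLIER-RESPONSE KERNEL**: for every blocking `N`, every period `Lc`, all legs,
`Σ'_u 𝟙[u_κ ≡ Lc − 1 (mod Lc)]·wΦ_N l κ (t − u) = 0` — the indicator is `1∕Lc + (coarse gradient of the bounded potential u ↦ −(u_κ mod Lc)∕Lc)` in direction `κ` (and gradient-free
across), so zero mass (`tsum_wΦ_sub_left`) and the bounded coarse Ward identity (`tsum_wΦ_mul_grad_eq_zero_bdd`) kill it. -/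
theorem tsum_exitInd_mul_wΦ_eq_zero {N : ℕ} [NeZero N] (l κ : Fin (d + 1)) (t : Site (d + 1)) :
    ∑' u : Site (d + 1), (if u κ % (Lc : ℤ) = (Lc : ℤ) - 1 then (1 : ℝ) else 0) * wΦ (N := N) (d := d) l κ (t - u) = 0 := by
  classical
  have hLc1 : 1 ≤ Lc := one_le_of_neZero Lc
  have hLpos : (0 : ℤ) < Lc := by exact_mod_cast hLc1
  have hLne : (Lc : ℝ) ≠ 0 := by exact_mod_cast NeZero.ne Lc
  -- the bounded potential and its coarse gradient
  set ζ : Site (d + 1) → ℝ := fun u => -((((u κ % (Lc : ℤ)) : ℤ) : ℝ)) / (Lc : ℝ) with hζ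
  have hζb : ∀ u, |ζ u| ≤ 1 := by
    intro u
    have h0 : (0 : ℝ) ≤ (((u κ % (Lc : ℤ)) : ℤ) : ℝ) := by exact_mod_cast Int.emod_nonneg _ hLpos.ne'
    have h1 : (((u κ % (Lc : ℤ)) : ℤ) : ℝ) < Lc := by exact_mod_cast Int.emod_lt_of_pos _ hLpos
    have hL : (0 : ℝ) < Lc := by exact_mod_cast hLpos
    show |-((((u κ % (Lc : ℤ)) : ℤ) : ℝ)) / (Lc : ℝ)| ≤ 1
    rw [abs_div, abs_neg, abs_of_nonneg h0, abs_of_pos hL, div_le_one hL]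
    exact h1.le
  have hgrad : ∀ (l' : Fin (d + 1)) (u : Site (d + 1)), ζ (u + unitVec l') - ζ u
      = if l' = κ then ((if u κ % (Lc : ℤ) = (Lc : ℤ) - 1 then (1 : ℝ) else 0) - (Lc : ℝ)⁻¹) else 0 := by
    intro l' u
    by_cases hl : l' = κ
    · rw [if_pos hl, hl]
      have eκ : (u + unitVec κ) κ = u κ + 1 := by simp [unitVec_apply]
      simp only [hζ, eκ, emod_add_one_eq hLpos (u κ)]
      by_cases hx : u κ % (Lc : ℤ) = (Lc : ℤ) - 1
      · rw [if_pos hx, if_pos hx, hx]; push_cast; field_simp; ring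
      · rw [if_neg hx, if_neg hx]; push_cast; field_simp; ring
    · rw [if_neg hl]
      have eκ : (u + unitVec l') κ = u κ := by
        simp only [Pi.add_apply, unitVec_apply]
        rw [if_neg (fun h => hl h.symm), add_zero]
      simp only [hζ, eκ, sub_self]
  -- the coarse Ward identity for `ζ`, collapsed to direction `κ`
  have hward := tsum_wΦ_mul_grad_eq_zero_bdd (M := N) (d := d) l t hζb
  simp only [hgrad, mul_ite, mul_zero, Finset.sum_ite_eq', Finset.mem_univ, if_true] at hward
  -- summability of the shifted kernel and splitting
  have hws : Summable fun u : Site (d + 1) => wΦ (N := N) (d := d) l κ (t - u) := by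
    have h := (Equiv.subLeft t).summable_iff.2 (summable_wΦ (N := N) (d := d) l κ)
    exact h.congr fun u => by simp [Equiv.subLeft]
  have hs1 : Summable fun u : Site (d + 1) => wΦ (N := N) (d := d) l κ (t - u) * (if u κ % (Lc : ℤ) = (Lc : ℤ) - 1 then (1 : ℝ) else 0) :=
    (summable_bdd_mul hws (fun u => show |(if u κ % (Lc : ℤ) = (Lc : ℤ) - 1 then (1 : ℝ) else 0)| ≤ 1 by split_ifs <;> simp)).congr fun u => by ring
  have e : (∑' u : Site (d + 1), wΦ (N := N) (d := d) l κ (t - u) * ((if u κ % (Lc : ℤ) = (Lc : ℤ) - 1 then (1 : ℝ) else 0) - (Lc : ℝ)⁻¹))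
      = (∑' u : Site (d + 1), (if u κ % (Lc : ℤ) = (Lc : ℤ) - 1 then (1 : ℝ) else 0) * wΦ (N := N) (d := d) l κ (t - u))
        - (Lc : ℝ)⁻¹ * ∑' u : Site (d + 1), wΦ (N := N) (d := d) l κ (t - u) := by
    rw [← tsum_mul_left, ← Summable.tsum_sub (hs1.congr fun u => by ring) (hws.mul_left _)]
    exact tsum_congr fun u => by ring
  rw [e, tsum_wΦ_sub_left, mul_zero, sub_zero] at hward
  exact hward
/-! ## §2 The multiplier response of the explicit source form -/

/-- NOT IN PRINT; OUR BOOKKEEPING.  **THE MULTIPLIER RESPONSE OF `n⋆` IS THAT OF `c·Π^ρ m̃`** (in-block root `ρ = toSite r`, every `c α β`, every multiplier bond `(l, t)` of `G_0`):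
`Σ_κ₀ Σ'_u n⋆ κ₀ u·colM G_0 Lc κ₀ u l t = Σ'_v Σ_l′ wΦ_{Lc^{0+1}} l l′ (t − v)·(c·Π^ρ m̃)(l′,v)` — `Π^ρ(c·Π^ρ m̃) = c·Π^ρ m̃`, the exit-indicator correction reads nothing (§1), `colM G_0 = wΦ_{Lc}`. -/
theorem multResponse_explicitSourceForm_eq {r : Fin (d + 1) → ℕ} (hr : r ∈ box (d + 1) Lc) (c : ℝ) (α β : Fin (d + 1)) (l : Fin (d + 1)) (t : Site (d + 1)) :
    ∑ κ₀, ∑' u : Site (d + 1),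
        (axProjAt (toSite r) Lc
            (fun l v => c * axProjAt (toSite r) Lc
              (fun l x => (if l = α then ((Lc : ℝ) ^ 2)⁻¹ * (((x β % (Lc : ℤ) : ℤ)) : ℝ) else 0)
                - (if l = β then (Lc : ℝ)⁻¹ * (if x β % (Lc : ℤ) = (Lc : ℤ) - 1 then (1 : ℝ) else 0) * (((x α % (Lc : ℤ) : ℤ)) : ℝ) else 0)) l v) κ₀ u
          - ((Lc : ℝ) ^ (d + 1))⁻¹ * (contourSum Lc
            (fun l v => c * axProjAt (toSite r) Lc
              (fun l x => (if l = α then ((Lc : ℝ) ^ 2)⁻¹ * (((x β % (Lc : ℤ) : ℤ)) : ℝ) else 0)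
                - (if l = β then (Lc : ℝ)⁻¹ * (if x β % (Lc : ℤ) = (Lc : ℤ) - 1 then (1 : ℝ) else 0) * (((x α % (Lc : ℤ) : ℤ)) : ℝ) else 0)) l v) κ₀ 0
            * (if u κ₀ % (Lc : ℤ) = (Lc : ℤ) - 1 then (1 : ℝ) else 0)))
        * colM (coDressKBmAt (toSite r) Lc (KInvStep (d := d) Lc 0)) Lc κ₀ u l t
      = ∑' v : Site (d + 1), ∑ l' : Fin (d + 1), wΦ (N := Lc ^ (0 + 1)) l l' (t - v)
          * (c * axProjAt (toSite r) Lc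
              (fun l x => (if l = α then ((Lc : ℝ) ^ 2)⁻¹ * (((x β % (Lc : ℤ) : ℤ)) : ℝ) else 0)
                - (if l = β then (Lc : ℝ)⁻¹ * (if x β % (Lc : ℤ) = (Lc : ℤ) - 1 then (1 : ℝ) else 0) * (((x α % (Lc : ℤ) : ℤ)) : ℝ) else 0)) l' v) := by
  classical
  have hLc1 : 1 ≤ Lc := one_le_of_neZero Lc
  -- abbreviations
  set P : Form1 (d + 1) ℝ := fun l v => c * axProjAt (toSite r) Lc
      (fun l x => (if l = α then ((Lc : ℝ) ^ 2)⁻¹ * (((x β % (Lc : ℤ) : ℤ)) : ℝ) else 0)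
        - (if l = β then (Lc : ℝ)⁻¹ * (if x β % (Lc : ℤ) = (Lc : ℤ) - 1 then (1 : ℝ) else 0) * (((x α % (Lc : ℤ) : ℤ)) : ℝ) else 0)) l v with hP
  -- `Π^ρ P = P`
  have hProj : axProjAt (toSite r) Lc P = P := by
    rw [hP]; exact axProjAt_explicitPotential_eq_self hLc1 hr _ c
  -- `P` is bounded (block-periodic)
  obtain ⟨BP, hBP⟩ := exists_abs_le_of_blockPeriodic hLc1 P (fun l v z => explicitPotential_blockPeriodic (toSite r) c α β l v z)
  -- the multiplier column in the `wΦ` letters, and its summability in the data index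
  have hcol : ∀ κ₀ (u : Site (d + 1)), colM (coDressKBmAt (toSite r) Lc (KInvStep (d := d) Lc 0)) Lc κ₀ u l t = wΦ (N := Lc ^ (0 + 1)) l κ₀ (t - u) := fun κ₀ u => by
    rw [colM_coDressKBmAt, colM_KInvStep]
  have hws : ∀ κ₀, Summable fun u : Site (d + 1) => wΦ (N := Lc ^ (0 + 1)) (d := d) l κ₀ (t - u) := fun κ₀ => by
    have h := (Equiv.subLeft t).summable_iff.2 (summable_wΦ (N := Lc ^ (0 + 1)) (d := d) l κ₀)
    exact h.congr fun u => by simp [Equiv.subLeft]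
  have hsP : ∀ κ₀, Summable fun u : Site (d + 1) => P κ₀ u * wΦ (N := Lc ^ (0 + 1)) (d := d) l κ₀ (t - u) := fun κ₀ =>
    summable_bdd_mul (hws κ₀) (fun u => hBP κ₀ u)
  have hsE : ∀ κ₀, Summable fun u : Site (d + 1) =>
      ((Lc : ℝ) ^ (d + 1))⁻¹ * (contourSum Lc P κ₀ 0 * (if u κ₀ % (Lc : ℤ) = (Lc : ℤ) - 1 then (1 : ℝ) else 0)) * wΦ (N := Lc ^ (0 + 1)) (d := d) l κ₀ (t - u) :=
    fun κ₀ => summable_bdd_mul (hws κ₀) (fun u => show |((Lc : ℝ) ^ (d + 1))⁻¹ * (contourSum Lc P κ₀ 0 * (if u κ₀ % (Lc : ℤ) = (Lc : ℤ) - 1 then (1 : ℝ) else 0))|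
        ≤ |((Lc : ℝ) ^ (d + 1))⁻¹ * contourSum Lc P κ₀ 0| by
      rw [abs_mul, abs_mul, abs_mul]
      refine mul_le_mul_of_nonneg_left ?_ (abs_nonneg _)
      exact mul_le_of_le_one_right (abs_nonneg _) (by split_ifs <;> simp))
  -- rewrite the statement in the abbreviations
  show (∑ κ₀, ∑' u : Site (d + 1), (axProjAt (toSite r) Lc P κ₀ u
      - ((Lc : ℝ) ^ (d + 1))⁻¹ * (contourSum Lc P κ₀ 0 * (if u κ₀ % (Lc : ℤ) = (Lc : ℤ) - 1 then (1 : ℝ) else 0)))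
        * colM (coDressKBmAt (toSite r) Lc (KInvStep (d := d) Lc 0)) Lc κ₀ u l t)
      = ∑' v : Site (d + 1), ∑ l' : Fin (d + 1), wΦ (N := Lc ^ (0 + 1)) l l' (t - v) * P l' v
  rw [hProj]
  simp only [hcol]
  -- split the data leg: the `P` part and the exit-indicator correction
  have e1 : ∀ κ₀, (∑' u : Site (d + 1), (P κ₀ u - ((Lc : ℝ) ^ (d + 1))⁻¹ * (contourSum Lc P κ₀ 0 * (if u κ₀ % (Lc : ℤ) = (Lc : ℤ) - 1 then (1 : ℝ) else 0)))
        * wΦ (N := Lc ^ (0 + 1)) (d := d) l κ₀ (t - u))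
      = ∑' u : Site (d + 1), P κ₀ u * wΦ (N := Lc ^ (0 + 1)) (d := d) l κ₀ (t - u) := by
    intro κ₀
    have esub : (fun u : Site (d + 1) => (P κ₀ u - ((Lc : ℝ) ^ (d + 1))⁻¹ * (contourSum Lc P κ₀ 0 * (if u κ₀ % (Lc : ℤ) = (Lc : ℤ) - 1 then (1 : ℝ) else 0)))
          * wΦ (N := Lc ^ (0 + 1)) (d := d) l κ₀ (t - u))
        = fun u => P κ₀ u * wΦ (N := Lc ^ (0 + 1)) (d := d) l κ₀ (t - u)
          - ((Lc : ℝ) ^ (d + 1))⁻¹ * (contourSum Lc P κ₀ 0 * (if u κ₀ % (Lc : ℤ) = (Lc : ℤ) - 1 then (1 : ℝ) else 0)) * wΦ (N := Lc ^ (0 + 1)) (d := d) l κ₀ (t - u) := by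
      funext u; ring
    rw [esub, Summable.tsum_sub (hsP κ₀) (hsE κ₀)]
    have ez : (∑' u : Site (d + 1), ((Lc : ℝ) ^ (d + 1))⁻¹ * (contourSum Lc P κ₀ 0 * (if u κ₀ % (Lc : ℤ) = (Lc : ℤ) - 1 then (1 : ℝ) else 0))
        * wΦ (N := Lc ^ (0 + 1)) (d := d) l κ₀ (t - u)) = 0 := by
      have e2 : (fun u : Site (d + 1) => ((Lc : ℝ) ^ (d + 1))⁻¹ * (contourSum Lc P κ₀ 0 * (if u κ₀ % (Lc : ℤ) = (Lc : ℤ) - 1 then (1 : ℝ) else 0))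
            * wΦ (N := Lc ^ (0 + 1)) (d := d) l κ₀ (t - u))
          = fun u => (((Lc : ℝ) ^ (d + 1))⁻¹ * contourSum Lc P κ₀ 0)
            * ((if u κ₀ % (Lc : ℤ) = (Lc : ℤ) - 1 then (1 : ℝ) else 0) * wΦ (N := Lc ^ (0 + 1)) (d := d) l κ₀ (t - u)) := by
        funext u; ring
      rw [e2, tsum_mul_left, tsum_exitInd_mul_wΦ_eq_zero (Lc := Lc) (N := Lc ^ (0 + 1)) l κ₀ t, mul_zero]
    rw [ez, sub_zero]
  rw [Finset.sum_congr rfl fun κ₀ _ => e1 κ₀, ← Summable.tsum_finsetSum (fun κ₀ _ => hsP κ₀)]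
  exact tsum_congr fun u => Finset.sum_congr rfl fun κ₀ _ => by ring
/-! ## §3 The `σ`-term vanishes at the explicit source form -/

/-- NOT IN PRINT; OUR BOOKKEEPING.  **THE `σ`-TERM OF THE LEVEL-ONE CLOSED FORM VANISHES AT `n⋆`** (`Lc` odd is NOT needed here; centred root `ρ = toSite (ctrOff (d+1) Lc)`, `α ≠ β`,
every slot `(ν, y′)` of `G_1`, every `c`, every block label `y`): with `h = colH G_1 Lc ν y′`,
`Σ'_Y Σ_κ (Σ_l Σ'_t h l t·colM G_0 Lc l t κ Y)·((1_{B(y)}(Y) + 1_{B(y)}(Y+e_κ))·n⋆ κ Y) = 0`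
— (E3) makes `C_0 h` the coarse gradient `(stepScale_1∕wVH_1)·𝒬ᵀ(colM G_1(ν,y′))`, adjointness moves `𝒬` onto `σ⊙n⋆`, and (ΛS) `𝒬(σ_{1_{B(y)}}⊙n⋆) = 0`. -/
theorem sigmaWeight_multResponse_explicitSourceForm_eq_zero {α β : Fin (d + 1)} (hαβ : α ≠ β) (c : ℝ) (ν : Fin (d + 1)) (y' y : Site (d + 1)) :
    ∑' Y : Site (d + 1), ∑ κ : Fin (d + 1),
        (∑ l, ∑' t : Site (d + 1), colH (coDressKBmAt (toSite (ctrOff (d + 1) Lc)) Lc (KInvStep (d := d) Lc (0 + 1))) Lc ν y' l t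
            * colM (coDressKBmAt (toSite (ctrOff (d + 1) Lc)) Lc (KInvStep (d := d) Lc 0)) Lc l t κ Y)
          * (((if blk Lc Y = y then (1 : ℝ) else 0) + (if blk Lc (Y + unitVec κ) = y then (1 : ℝ) else 0))
            * (axProjAt (toSite (ctrOff (d + 1) Lc)) Lc
                (fun l v => c * axProjAt (toSite (ctrOff (d + 1) Lc)) Lc
                  (fun l x => (if l = α then ((Lc : ℝ) ^ 2)⁻¹ * (((x β % (Lc : ℤ) : ℤ)) : ℝ) else 0)
                    - (if l = β then (Lc : ℝ)⁻¹ * (if x β % (Lc : ℤ) = (Lc : ℤ) - 1 then (1 : ℝ) else 0) * (((x α % (Lc : ℤ) : ℤ)) : ℝ) else 0)) l v) κ Y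
              - ((Lc : ℝ) ^ (d + 1))⁻¹ * (contourSum Lc
                (fun l v => c * axProjAt (toSite (ctrOff (d + 1) Lc)) Lc
                  (fun l x => (if l = α then ((Lc : ℝ) ^ 2)⁻¹ * (((x β % (Lc : ℤ) : ℤ)) : ℝ) else 0)
                    - (if l = β then (Lc : ℝ)⁻¹ * (if x β % (Lc : ℤ) = (Lc : ℤ) - 1 then (1 : ℝ) else 0) * (((x α % (Lc : ℤ) : ℤ)) : ℝ) else 0)) l v) κ 0
                * (if Y κ % (Lc : ℤ) = (Lc : ℤ) - 1 then (1 : ℝ) else 0)))) = 0 := by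
  classical
  have hLc1 : 1 ≤ Lc := one_le_of_neZero Lc
  have hr := ctrOff_mem_box (d := d + 1) hLc1
  set G1 : MKer (d + 1) (Fib d) := coDressKBmAt (toSite (ctrOff (d + 1) Lc)) Lc (KInvStep (d := d) Lc (0 + 1)) with hG1def
  -- the datum `n⋆` and the weight `m = σ⊙n⋆`
  set nS : Form1 (d + 1) ℝ := fun κ Y => (axProjAt (toSite (ctrOff (d + 1) Lc)) Lc
      (fun l v => c * axProjAt (toSite (ctrOff (d + 1) Lc)) Lc
        (fun l x => (if l = α then ((Lc : ℝ) ^ 2)⁻¹ * (((x β % (Lc : ℤ) : ℤ)) : ℝ) else 0)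
          - (if l = β then (Lc : ℝ)⁻¹ * (if x β % (Lc : ℤ) = (Lc : ℤ) - 1 then (1 : ℝ) else 0) * (((x α % (Lc : ℤ) : ℤ)) : ℝ) else 0)) l v) κ Y
    - ((Lc : ℝ) ^ (d + 1))⁻¹ * (contourSum Lc
      (fun l v => c * axProjAt (toSite (ctrOff (d + 1) Lc)) Lc
        (fun l x => (if l = α then ((Lc : ℝ) ^ 2)⁻¹ * (((x β % (Lc : ℤ) : ℤ)) : ℝ) else 0)
          - (if l = β then (Lc : ℝ)⁻¹ * (if x β % (Lc : ℤ) = (Lc : ℤ) - 1 then (1 : ℝ) else 0) * (((x α % (Lc : ℤ) : ℤ)) : ℝ) else 0)) l v) κ 0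
      * (if Y κ % (Lc : ℤ) = (Lc : ℤ) - 1 then (1 : ℝ) else 0))) with hnS
  obtain ⟨BS, hBS⟩ := exists_abs_explicitSourceForm_le (d := d) (Lc := Lc) (toSite (ctrOff (d + 1) Lc)) c α β
  have hnSb : ∀ κ Y, |nS κ Y| ≤ BS := fun κ Y => hBS κ Y
  set m : Form1 (d + 1) ℝ := fun κ Y => ((if blk Lc Y = y then (1 : ℝ) else 0) + (if blk Lc (Y + unitVec κ) = y then (1 : ℝ) else 0)) * nS κ Y with hm
  have hone : ∀ (Q : Prop) [Decidable Q], |(if Q then (1 : ℝ) else 0)| ≤ 1 := fun Q _ => by split <;> simp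
  have hBS0 : 0 ≤ BS := (abs_nonneg _).trans (hBS 0 0)
  have hmb : ∀ κ Y, |m κ Y| ≤ 2 * BS := fun κ Y => by
    rw [hm]
    simp only []
    rw [abs_mul]
    refine mul_le_mul (((abs_add_le _ _).trans (add_le_add (hone _) (hone _))).trans (by norm_num)) (hnSb κ Y) (abs_nonneg _) (by norm_num)
  -- the slot datum is summable along every direction
  have hh : ∀ l, Summable fun t : Site (d + 1) => colH G1 Lc ν y' l t := fun l => summable_colH hr (0 + 1) ν y' l
  -- `C_0 h` in the `wΦ` letters, then (E3)
  set β' : Form1 (d + 1) ℝ := colM G1 Lc ν y' with hβ'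
  have hwVH : wVH d Lc (0 + 1) ≠ 0 := by
    unfold BalabanStepJetsSucc.wVH; exact pow_ne_zero _ (pow_ne_zero _ (by exact_mod_cast NeZero.ne Lc))
  have hC : ∀ (κ : Fin (d + 1)) (Y : Site (d + 1)), (∑ l, ∑' t : Site (d + 1), colH G1 Lc ν y' l t
      * colM (coDressKBmAt (toSite (ctrOff (d + 1) Lc)) Lc (KInvStep (d := d) Lc 0)) Lc l t κ Y)
      = (wVH d Lc (0 + 1))⁻¹ * stepScale d Lc (0 + 1) * contourSumAdj Lc β' κ Y := by
    intro κ Y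
    rw [slotSum_mul_colM_eq hr 0 hh κ Y]
    have hE3 := E2row_colH_eq_contourSumAdj_colM_succ (d := d) hr 0 ν y' κ Y
    rw [← hG1def] at hE3
    have e : (∑' t : Site (d + 1), ∑ l, wΦ (N := Lc ^ (0 + 1)) κ l (Y - t) * colH G1 Lc ν y' l t)
        = (wVH d Lc (0 + 1))⁻¹ * (wVH d Lc (0 + 1) * ∑' v : Site (d + 1), ∑ l : Fin (d + 1), wΦ (N := Lc ^ (0 + 1)) κ l (Y - v) * colH G1 Lc ν y' l v) := by
      rw [← mul_assoc, inv_mul_cancel₀ hwVH, one_mul]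
    rw [e, hE3, hβ']
    ring
  show ∑' Y : Site (d + 1), ∑ κ : Fin (d + 1), (∑ l, ∑' t : Site (d + 1), colH G1 Lc ν y' l t
      * colM (coDressKBmAt (toSite (ctrOff (d + 1) Lc)) Lc (KInvStep (d := d) Lc 0)) Lc l t κ Y) * m κ Y = 0
  simp only [hC]
  -- adjointness
  obtain ⟨C1, δ1, hδ1, hG1d⟩ := spr_coDressKBmAt hLc1 hr (spr_KInvStep (d := d) (Lc := Lc) (0 + 1))
  have hφ : ∀ κ, Summable fun u : Site (d + 1) => |β' κ (quo Lc u)| := fun κ => by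
    have := summable_abs_comp_quo (N := Lc) hLc1 hδ1 hG1d ((Lc : ℤ) • y') (Sum.inr κ) (Sum.inr ν)
    exact this.congr fun u => by simp only [hβ', hG1def, SecondOrderResponse.colM]
  have e1 : (∑' Y : Site (d + 1), ∑ κ : Fin (d + 1), (wVH d Lc (0 + 1))⁻¹ * stepScale d Lc (0 + 1) * contourSumAdj Lc β' κ Y * m κ Y)
      = (wVH d Lc (0 + 1))⁻¹ * stepScale d Lc (0 + 1) * ∑' Y : Site (d + 1), ∑ κ : Fin (d + 1), m κ Y * contourSumAdj Lc β' κ Y := by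
    rw [← tsum_mul_left]
    refine tsum_congr fun Y => ?_
    rw [Finset.mul_sum]
    exact Finset.sum_congr rfl fun κ _ => by ring
  rw [e1, tsum_mul_contourSumAdj_bdd (N := Lc) hmb hφ]
  -- (ΛS): every contour sum of `σ⊙n⋆` vanishes
  have hΛS : ∀ (κ : Fin (d + 1)) (w : Site (d + 1)), contourSum Lc m κ w = 0 := fun κ w => by
    rw [hm, hnS]
    exact contourSum_bondSum_blockInd_explicitSourceForm_eq_zero (d := d) hr hαβ c y κ w
  simp only [hΛS, mul_zero, Finset.sum_const_zero, tsum_zero]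
/-! ## §4 Road-P2's `hX` at `j = 0` -/

/-- NOT IN PRINT; OUR BOOKKEEPING.  **ROAD-P2's `hX` AT THE BASE LEVEL `j = 0`, AT BAŁABAN's PINS** (`Lc` odd, centred root `ρ = toSite (ctrOff (d+1) Lc)`, `cE = Lc^{d+1}`,
`cVH = −(Lc^{d+1}·½·Lc^{d+1})`, EVERY `cΛ`, `α ≠ β`, every block label `y`, every `ν`): the displayed hypothesis `hX` of
`ExplicitSourceFormLambdaShare.moments_sigmaPair_exit_succ_of_columnPairing` with `j := 0` — for every slot position `y′` and every `c`, IF the exit⊗exit charge of `SpureRecAt … (0+1)`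
is `wVH_1·Σ'_v Σ_l wΦ_{Lc} ν l (y′ − v)·(c·Π^ρ m̃)(l,v)` at every coarse bond, THEN
`(cE·wE_1)·X_1(colH G_1(ν,y′); n⋆_c, 1_{B(y)}) = −½·stepScale_1·Lc^{d+1}·Σ'_u Σ_κ 1_{B(y)}(u + e_κ)·colH G_1 Lc ν y′ κ u·C^{ee}(S_1)(κ,u)`
— PART 2's closed form at `n := n⋆` (road-P2's `ExplicitSourceFormPeriodic` for the two hypotheses), §3 (the `σ`-term vanishes), §2 (`C_0 n⋆ = C_0(c·Π^ρ m̃)`), the weight identity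
`cE·wE_1 = stepScale_1·Lc^{d+1}·wVH_1`. -/
theorem columnPairing_levelOne_explicitSourceForm (hLc : Odd Lc) (cΛ : ℝ) (y : Site (d + 1)) (ν : Fin (d + 1)) {α β : Fin (d + 1)} (hαβ : α ≠ β)
    (y' : Site (d + 1)) (c : ℝ)
    (hC : ∀ (ν : Fin (d + 1)) (y' : Site (d + 1)), ∑' xz : Site (d + 1) × Site (d + 1),
        (if xz.1 α % (Lc : ℤ) = (Lc : ℤ) - 1 then (1 : ℝ) else 0) * (if xz.2 β % (Lc : ℤ) = (Lc : ℤ) - 1 then (1 : ℝ) else 0)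
          * SpureRecAt d Lc (toSite (ctrOff (d + 1) Lc)) ((Lc : ℝ) ^ (d + 1)) (-((Lc : ℝ) ^ (d + 1) * (1 / 2) * (Lc : ℝ) ^ (d + 1))) cΛ (0 + 1)
              ν y' xz.1 xz.2 (Sum.inl α) (Sum.inl β)
        = wVH d Lc (0 + 1) * ∑' v, ∑ l : Fin (d + 1), wΦ (N := Lc ^ (0 + 1)) ν l (y' - v) * (c * axProjAt (toSite (ctrOff (d + 1) Lc)) Lc
            (fun l x => (if l = α then ((Lc : ℝ) ^ 2)⁻¹ * (((x β % (Lc : ℤ) : ℤ)) : ℝ) else 0)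
              - (if l = β then (Lc : ℝ)⁻¹ * (if x β % (Lc : ℤ) = (Lc : ℤ) - 1 then (1 : ℝ) else 0) * (((x α % (Lc : ℤ) : ℤ)) : ℝ) else 0)) l v)) :
    ((Lc : ℝ) ^ (d + 1) * wE d Lc (0 + 1)) * (∑ l, ∑' t, colH (coDressKBmAt (toSite (ctrOff (d + 1) Lc)) Lc (KInvStep (d := d) Lc (0 + 1))) Lc ν y' l t
          * ∑' ux : Site (d + 1) × Site (d + 1), ∑ κ, ∑ κ₂,
              (axProjAt (toSite (ctrOff (d + 1) Lc)) Lc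
                  (fun l v => c * axProjAt (toSite (ctrOff (d + 1) Lc)) Lc
                (fun l x => (if l = α then ((Lc : ℝ) ^ 2)⁻¹ * (((x β % (Lc : ℤ) : ℤ)) : ℝ) else 0)
              - (if l = β then (Lc : ℝ)⁻¹ * (if x β % (Lc : ℤ) = (Lc : ℤ) - 1 then (1 : ℝ) else 0) * (((x α % (Lc : ℤ) : ℤ)) : ℝ) else 0)) l v) κ ux.1
                - ((Lc : ℝ) ^ (d + 1))⁻¹ * (contourSum Lc
                  (fun l v => c * axProjAt (toSite (ctrOff (d + 1) Lc)) Lc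
                (fun l x => (if l = α then ((Lc : ℝ) ^ 2)⁻¹ * (((x β % (Lc : ℤ) : ℤ)) : ℝ) else 0)
              - (if l = β then (Lc : ℝ)⁻¹ * (if x β % (Lc : ℤ) = (Lc : ℤ) - 1 then (1 : ℝ) else 0) * (((x α % (Lc : ℤ) : ℤ)) : ℝ) else 0)) l v) κ 0
                  * (if ux.1 κ % (Lc : ℤ) = (Lc : ℤ) - 1 then (1 : ℝ) else 0)))
              * dz (fun z : Site (d + 1) => if blk Lc z = y then (1 : ℝ) else 0) κ₂ ux.2
              * e3OfK Lc (coDressKBmAt (toSite (ctrOff (d + 1) Lc)) Lc (KInvStep (d := d) Lc 0))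
                  (SrecAt d Lc (toSite (ctrOff (d + 1) Lc)) ((Lc : ℝ) ^ (d + 1)) (-((Lc : ℝ) ^ (d + 1) * (1 / 2) * (Lc : ℝ) ^ (d + 1))) cΛ 0)
                  l t ux.1 ux.2 (Sum.inl κ) (Sum.inl κ₂))
        = (-(stepScale d Lc (0 + 1) * (Lc : ℝ) ^ (d + 1)) / 2) * ∑' u : Site (d + 1), ∑ κ : Fin (d + 1), (if blk Lc (u + Pi.single κ 1) = y then (1 : ℝ) else 0)
            * colH (coDressKBmAt (toSite (ctrOff (d + 1) Lc)) Lc (KInvStep (d := d) Lc (0 + 1))) Lc ν y' κ u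
            * ∑' xz : Site (d + 1) × Site (d + 1), ((if xz.1 α % (Lc : ℤ) = (Lc : ℤ) - 1 then (1 : ℝ) else 0) * (if xz.2 β % (Lc : ℤ) = (Lc : ℤ) - 1 then (1 : ℝ) else 0))
            * SpureRecAt d Lc (toSite (ctrOff (d + 1) Lc)) ((Lc : ℝ) ^ (d + 1)) (-((Lc : ℝ) ^ (d + 1) * (1 / 2) * (Lc : ℝ) ^ (d + 1))) cΛ (0 + 1)
                κ u xz.1 xz.2 (Sum.inl α) (Sum.inl β) := by
  classical
  have hLc1 : 1 ≤ Lc := one_le_of_neZero Lc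
  have hr := ctrOff_mem_box (d := d + 1) hLc1
  -- the two hypotheses of the datum `n⋆`
  obtain ⟨BS, hBS⟩ := exists_abs_explicitSourceForm_le (d := d) (Lc := Lc) (toSite (ctrOff (d + 1) Lc)) c α β
  have hper := fun (l : Fin (d + 1)) (t z : Site (d + 1)) => explicitSourceForm_blockPeriodic (d := d) (Lc := Lc) (toSite (ctrOff (d + 1) Lc)) c α β l t z
  -- PART 2 at `n := n⋆` (member `0` of `SrecAt` is `S0NAt`)
  rw [SrecAt_zero, sourcePairing_levelOne_closed (d := d) hLc cΛ ν y' hBS hper y,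
    sigmaWeight_multResponse_explicitSourceForm_eq_zero (d := d) (Lc := Lc) hαβ c ν y' y, mul_zero, add_zero]
  -- `C_0 n⋆ = C_0 (c·Π^ρ m̃)`, the hypothesis on the exit⊗exit charge
  simp only [multResponse_explicitSourceForm_eq hr c α β]
  -- summability of the slot family (the multiplier response of bounded data is bounded)
  obtain ⟨BP, hBP⟩ := exists_abs_le_of_blockPeriodic hLc1 (fun l v => c * axProjAt (toSite (ctrOff (d + 1) Lc)) Lc
      (fun l x => (if l = α then ((Lc : ℝ) ^ 2)⁻¹ * (((x β % (Lc : ℤ) : ℤ)) : ℝ) else 0)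
        - (if l = β then (Lc : ℝ)⁻¹ * (if x β % (Lc : ℤ) = (Lc : ℤ) - 1 then (1 : ℝ) else 0) * (((x α % (Lc : ℤ) : ℤ)) : ℝ) else 0)) l v)
    (fun l v z => explicitPotential_blockPeriodic (d := d) (Lc := Lc) (toSite (ctrOff (d + 1) Lc)) c α β l v z)
  have hh : ∀ l, Summable fun t : Site (d + 1) => colH (coDressKBmAt (toSite (ctrOff (d + 1) Lc)) Lc (KInvStep (d := d) Lc (0 + 1))) Lc ν y' l t :=
    fun l => summable_colH hr (0 + 1) ν y' l
  set W : Form1 (d + 1) ℝ := fun l t => ∑' v : Site (d + 1), ∑ l' : Fin (d + 1), wΦ (N := Lc ^ (0 + 1)) l l' (t - v)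
      * (c * axProjAt (toSite (ctrOff (d + 1) Lc)) Lc
          (fun l x => (if l = α then ((Lc : ℝ) ^ 2)⁻¹ * (((x β % (Lc : ℤ) : ℤ)) : ℝ) else 0)
            - (if l = β then (Lc : ℝ)⁻¹ * (if x β % (Lc : ℤ) = (Lc : ℤ) - 1 then (1 : ℝ) else 0) * (((x α % (Lc : ℤ) : ℤ)) : ℝ) else 0)) l' v) with hW
  have hC' : ∀ (κ : Fin (d + 1)) (u : Site (d + 1)), (∑' xz : Site (d + 1) × Site (d + 1),
      (if xz.1 α % (Lc : ℤ) = (Lc : ℤ) - 1 then (1 : ℝ) else 0) * (if xz.2 β % (Lc : ℤ) = (Lc : ℤ) - 1 then (1 : ℝ) else 0)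
        * SpureRecAt d Lc (toSite (ctrOff (d + 1) Lc)) ((Lc : ℝ) ^ (d + 1)) (-((Lc : ℝ) ^ (d + 1) * (1 / 2) * (Lc : ℝ) ^ (d + 1))) cΛ (0 + 1)
            κ u xz.1 xz.2 (Sum.inl α) (Sum.inl β)) = wVH d Lc (0 + 1) * W κ u := fun κ u => hC κ u
  -- the multiplier response of `c·Π^ρ m̃` is bounded: it is `C_0` of bounded data (`colM G_0 = wΦ_{Lc}`)
  obtain ⟨BC, hBC0, hCb⟩ := abs_multResponse_le (d := d) hr 0 hBP
  have hWb : ∀ (l : Fin (d + 1)) (t : Site (d + 1)), |W l t| ≤ BC := by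
    intro l t
    have e : W l t = ∑ κ₀, ∑' u : Site (d + 1), (c * axProjAt (toSite (ctrOff (d + 1) Lc)) Lc
        (fun l x => (if l = α then ((Lc : ℝ) ^ 2)⁻¹ * (((x β % (Lc : ℤ) : ℤ)) : ℝ) else 0)
          - (if l = β then (Lc : ℝ)⁻¹ * (if x β % (Lc : ℤ) = (Lc : ℤ) - 1 then (1 : ℝ) else 0) * (((x α % (Lc : ℤ) : ℤ)) : ℝ) else 0)) κ₀ u)
        * colM (coDressKBmAt (toSite (ctrOff (d + 1) Lc)) Lc (KInvStep (d := d) Lc 0)) Lc κ₀ u l t := by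
      rw [hW]
      simp only []
      rw [← Summable.tsum_finsetSum (fun κ₀ _ => (hCb l t).1 κ₀)]
      refine tsum_congr fun u => Finset.sum_congr rfl fun κ₀ _ => ?_
      rw [colM_coDressKBmAt, colM_KInvStep]
      ring
    rw [e]
    exact (hCb l t).2
  -- both sides as the same double sum
  have hsum : ∀ l, Summable fun t : Site (d + 1) => colH (coDressKBmAt (toSite (ctrOff (d + 1) Lc)) Lc (KInvStep (d := d) Lc (0 + 1))) Lc ν y' l t
      * ((if blk Lc (t + unitVec l) = y then (1 : ℝ) else 0) * W l t) := fun l =>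
    (summable_bdd_mul (hh l) (fun t => show |(if blk Lc (t + unitVec l) = y then (1 : ℝ) else 0) * W l t| ≤ 1 * BC by
      rw [abs_mul]; exact mul_le_mul (by split_ifs <;> simp) (hWb l t) (abs_nonneg _) zero_le_one)).congr fun t => by ring
  have eU : ∀ (κ : Fin (d + 1)) (u : Site (d + 1)), u + Pi.single κ (1 : ℤ) = u + unitVec κ := fun κ u => rfl
  simp only [hC', eU]
  rw [Summable.tsum_finsetSum (fun l _ => ((hsum l).mul_left (wVH d Lc (0 + 1))).congr fun t => by ring)]
  have hw : (Lc : ℝ) ^ (d + 1) * wE d Lc (0 + 1) = stepScale d Lc (0 + 1) * (Lc : ℝ) ^ (d + 1) * wVH d Lc (0 + 1) := by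
    unfold BalabanStepJetsSucc.wE BalabanStepJetsSucc.wVH BorderedHessian.stepScale
    ring
  -- fold the multiplier response of `c·Π^ρ m̃` into `W` on the left
  have hW' : ∀ (l : Fin (d + 1)) (t : Site (d + 1)), (∑' v : Site (d + 1), ∑ l' : Fin (d + 1), wΦ (N := Lc ^ (0 + 1)) l l' (t - v)
      * (c * axProjAt (toSite (ctrOff (d + 1) Lc)) Lc
          (fun l x => (if l = α then ((Lc : ℝ) ^ 2)⁻¹ * (((x β % (Lc : ℤ) : ℤ)) : ℝ) else 0)
            - (if l = β then (Lc : ℝ)⁻¹ * (if x β % (Lc : ℤ) = (Lc : ℤ) - 1 then (1 : ℝ) else 0) * (((x α % (Lc : ℤ) : ℤ)) : ℝ) else 0)) l' v)) = W l t :=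
    fun l t => rfl
  simp only [hW']
  rw [hw]
  simp only [Finset.mul_sum, ← tsum_mul_left]
  refine Finset.sum_congr rfl fun l _ => tsum_congr fun t => ?_
  ring

end Summit.QuantumFields.BalabanUV.Beta.GAN24.SourcePairingLevelOneExplicit

end
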